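import Mathlib
import Literature.LinearAlgebra.Matrix.MaximumDeterminantCompletionExistence
import Summits.ValiantsHypothesis.ValiantsHypothesis.Theorems.LacunarySymmetroidMatrixDescartesCensusDoorA34DefiniteTriple

/-!
# Osculation-law line (crux `MatrixDescartes`, stmt-ValiantsHypothesis-18050): the letter split for `stub_recursion`, crude full-rank form

`Cruxes/MatrixDescartes/Lines/osculation_law.lean :: stub_recursion` («split the top letter `S = P − Q` with `P, Q ⪰ 0`, bring `P`
(then `Q`) to block-projector form by a congruence, peel twice per letter …») needs, for its first two steps, only this:
EVERY real symmetric matrix is a difference `S = YᵀY − c·I` with `Y` invertible and `c > 0`.  Hence the letter `t^d S` is inserted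
in two steps, `+ t^d · YᵀY` (after the congruence `Y⁻ᵀ(·)Y⁻¹`, which preserves the format, symmetry and the positive zeros of the
determinant, this is `+ t^d · I`, i.e. `blockProj m 0`: top rank `r = m`, no compression, the `3·Z₊(det G₂₂)` term of the peel
inequality vanishes) and `− c t^d · I` (= `+ c t^d · I` into `−G`).  No spectral splitting, no rank bookkeeping, no Sylvester normal
form for semidefinite letters is required; the recurrence becomes `Z(K) ≤ 4·Z(K−1) + 6ι + 6m`, inside the `2^{O(K + log² m)}` envelope.

By name from the tree: `Literature.LinearAlgebra.Matrix.exists_posDef_add_smul` (Dym, Lemma 38.1: `A ≻ 0`, `B` Hermitian ⇒ `A + μB ≻ 0`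
for `|μ| < δ`) and `…LacunarySymmetroidMatrixDescartes.Census.exists_common_congruence` (`A ≻ 0 ⇒ A = YᵀY`, `det Y ≠ 0`).
* `isHermitian_of_isSymm` — real symmetric ⇒ Hermitian;
* `exists_shift_posDef` — `∃ c > 0, (S + c·1) ≻ 0`;
* `exists_gram_sub_smul_one` — `∃ Y c, det Y ≠ 0 ∧ 0 < c ∧ S = YᵀY − c·1`.

HONEST FRAMING: two elementary helper lemmas for the bookkeeping stub of one line; the stub's real content (general position,
memo NOTE-p8g12-18050-stub_recursion-inputs-audit §R6) and the LAW `stub_osculationLaw` are untouched; 18050 OPEN; `VP ≠ VNP` NOT proved.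
-/

set_option autoImplicit false

-- the mandated summit-side namespace repeats a component by design (single-problem summit)
set_option linter.dupNamespace false

namespace Summit.ValiantsHypothesis.ValiantsHypothesis.Theorems.LacunarySymmetroidMatrixDescartes.OsculationRecursion

open Matrix

variable {n : Type*} [Fintype n] [DecidableEq n]

omit [Fintype n] [DecidableEq n] in
/-- A real symmetric matrix is Hermitian (the star on `ℝ` is trivial). -/
theorem isHermitian_of_isSymm (S : Matrix n n ℝ) (hS : S.IsSymm) : S.IsHermitian := by
  show Sᴴ = S
  rw [conjTranspose_eq_transpose_of_trivial]
  exact hS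

/-- **Definite shift.**  For every real symmetric `S` there is `c > 0` with `S + c·1` positive definite
(`1 + μS ≻ 0` for small `μ > 0` by `exists_posDef_add_smul`, then scale by `1/μ`). -/
theorem exists_shift_posDef (S : Matrix n n ℝ) (hS : S.IsSymm) : ∃ c : ℝ, 0 < c ∧ (S + c • (1 : Matrix n n ℝ)).PosDef := by
  obtain ⟨δ, hδ, hμ⟩ := Literature.LinearAlgebra.Matrix.exists_posDef_add_smul (A := (1 : Matrix n n ℝ)) (B := S)
    Matrix.PosDef.one (isHermitian_of_isSymm S hS)
  have hμ' : ((1 : Matrix n n ℝ) + ((δ / 2 : ℝ) : ℝ) • S).PosDef :=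
    hμ (δ / 2) (by rw [abs_of_pos (by positivity)]; linarith)
  refine ⟨2 / δ, by positivity, ?_⟩
  have hscale : S + (2 / δ) • (1 : Matrix n n ℝ) = (2 / δ) • ((1 : Matrix n n ℝ) + (δ / 2) • S) := by
    rw [smul_add, smul_smul, div_mul_div_comm, mul_comm 2 δ, div_self (by positivity), one_smul, add_comm]
  rw [hscale]
  exact hμ'.smul (by positivity)

/-- **Every real symmetric letter is «Gram minus a multiple of the identity».**  `S = YᵀY − c·1` with `det Y ≠ 0`, `c > 0`
(definite shift, then `exists_common_congruence` on the positive definite `S + c·1`). -/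
theorem exists_gram_sub_smul_one (S : Matrix n n ℝ) (hS : S.IsSymm) :
    ∃ (Y : Matrix n n ℝ) (c : ℝ), Y.det ≠ 0 ∧ 0 < c ∧ S = star Y * Y - c • (1 : Matrix n n ℝ) := by
  obtain ⟨c, hc, hP⟩ := exists_shift_posDef S hS
  obtain ⟨Y, β, hY, hA, -⟩ := Census.exists_common_congruence hP (isHermitian_of_isSymm S hS)
  exact ⟨Y, c, hY, hc, by rw [← hA, add_sub_cancel_right]⟩

end Summit.ValiantsHypothesis.ValiantsHypothesis.Theorems.LacunarySymmetroidMatrixDescartes.OsculationRecursion
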